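import Summits.Ventures.HSemireg.WedgeHankelClassSpaceIrreducibleCharP
import Summits.Ventures.HSemireg.WedgeApolarSiegelWindowDigits
import Mathlib.LinearAlgebra.Projection

/-!
# Venture HSemireg — SCHUR AND INDECOMPOSABILITY FOR TH-7's CLASS SPACE IN EVERY CHARACTERISTIC: over a field with an element `t` of multiplicative order `> n`, every
# endomorphism of `spikeSpan n` commuting with the torus element `SbC(1 0 0 t)` and the shear `SbC(1 1 0 1)` is a SCALAR — with NO condition on the binomial coefficients —
# hence the class space is INDECOMPOSABLE under the substitutions even where it is reducible (`n = p^e` in characteristic `p`: reducible but indecomposable)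

HONEST FRAMING. Part of the Lean index of the computation cell `pub-hsemireg` (seat p10 gen 21, Sunday typer «UNIFORM-IN-n»).
Finite-dimensional EXTERIOR ALGEBRA + linear algebra ONLY: no variety, no cohomology theory, no sheaf, no Ext group, no semiregularity map;
nothing here says that HC / HC_CM / HC_AV holds; no Literature fact is declared or used.  Custodian versions as in `WedgeHankelSiegelIdeal` (1/3) and `WedgeHankelFrameChange`;
the dictionary (`Sym^n V` is an indecomposable `GL₂`-module with scalar endomorphism ring in every characteristic over an infinite field, although it is reducible when
some `C(n,j)` vanishes) is QUOTED, never asserted.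

WHAT IS IN THE TREE.  J13 (`WedgeHankelClassSpaceSchur`): `eq_smul_one_of_commute_shear_swap` — Schur when `n! ≠ 0`; K3 (`WedgeHankelClassSpaceIrreducibleCharP`, this seat):
`SbC_diag_spikeBasis`, `repr_SbC_spikeBasis`, `exists_pow_injective_of_infinite`, the Siegel classes pulled back into `spikeSpan n` (`comap_siegel_ne_top`,
`comap_siegel_eq_bot_iff`, `SbC_mem_comap_siegel`) and the sharp irreducibility criterion.  THIS FILE (namespace `Summit.Ventures.HSemireg.Wedge.HankelFrameChange`
continued; imports K3, J16, `Mathlib.LinearAlgebra.Projection`) removes the binomial condition from Schur and draws indecomposability: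
* §285 SCHUR IN EVERY CHARACTERISTIC: `SbC_diag_eq_sum` / `repr_SbC_diag` (the torus is diagonal in th-7's basis: `repr (SbC(1 0 0 t) v) i = t^i · repr v i`),
  **`apply_spikeBasis_eq_smul_of_commute_torus`** (an endomorphism commuting with `SbC(1 0 0 t)`, `t^0, …, t^n` distinct, is diagonal in th-7's basis),
  `SbC_shear_one_spikeBasis_zero` (`SbC(1 1 0 1) E_0 = Σ_a E_a`), **`eq_smul_one_of_commute_torus_shear`: commuting with `SbC(1 0 0 t)` and `SbC(1 1 0 1)` forces `φ = c • 1`**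
  (compare coordinates of `φ(Σ_a E_a) = Σ_a c_a E_a` and `c_0 Σ_a E_a` — only the column `C(a,0) = 1` of the Pascal matrix is used, so NO binomial hypothesis),
  `eq_smul_one_of_forall_commute_SbC_of_pow_injective`, `eq_smul_one_of_forall_commute_SbC_of_infinite`.
* §286 INDECOMPOSABILITY: `commute_ofIsCompl_of_stable` (the projection onto `W` along a complement `W'`, both `f`-stable, commutes with `f`),
  **`eq_bot_or_eq_top_of_isCompl_stable`: if `W ⊕ W' = spikeSpan n` with BOTH summands stable under `SbC(1 0 0 t)` and `SbC(1 1 0 1)`, then `W = ⊥` or `W = ⊤`** — th-7's class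
  space is INDECOMPOSABLE under the substitutions (such `t` in `K`), `eq_bot_or_eq_top_of_isCompl_forall_SbC_stable`, `…_of_infinite`; and the contrast
  **`reducible_and_indecomposable_prime_pow`**: for `n = p^e`, `e ≥ 1`, characteristic `p`, `K` infinite, the class space HAS a proper non-zero subspace stable under all
  substitutions (the Siegel classes) but NO stable complement pair — reducible yet indecomposable.
* §294 THE NUMEROLOGY (with J16 `coSiegel_inf_siegelIdeal_eq_bot_iff_exists_digits`): **`forall_stable_eq_top_iff_exists_digits_of_infinite`: over an infinite field of
  characteristic `p`, th-7's class space of degree `n` is irreducible IFF `n + 1 = (d+1)·p^k`, `d < p`**; `forall_stable_eq_top_of_prime_pow_sub_one` (`n = p^k − 1` is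
  irreducible), `not_forall_stable_eq_top_prime_pow` (`n = p^e`, `e ≥ 1`, is not).
NOT typed here: finite fields with `|K| ≤ n`; the endomorphism ring of the Siegel-class submodule / quotient; anything Ext-side.  New names only.
-/

open Module

namespace Summit.Ventures.HSemireg.Wedge.HankelFrameChange

open Summit.Ventures.HSemireg.Wedge Summit.Ventures.HSemireg.Wedge.Kunneth Summit.Ventures.HSemireg.Wedge.Hankel
  Summit.Ventures.HSemireg.Wedge.BasisFree Summit.Ventures.HSemireg.Wedge.HankelSiegel Summit.Ventures.HSemireg.Wedge.HankelSiegelIdeal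
  Summit.Ventures.HSemireg.Wedge.KunnethKernel Summit.Ventures.HSemireg.Wedge.HankelRankOne Summit.Ventures.HSemireg.Wedge.KernelDuality

variable (K : Type*) [Field K] {n : ℕ}

/-! ## §285. Schur in every characteristic: torus + shear -/

/-- the torus acts diagonally in th-7's basis: `SbC(a 0 0 d) v = Σ_i (a^{n−i} d^i · repr v i) • E_i`. -/
theorem SbC_diag_eq_sum (a d : K) (v : spikeSpan K n) :
    SbC K a 0 0 d v = ∑ i : Fin (n + 1), (a ^ (n - (i : ℕ)) * d ^ (i : ℕ) * (spikeBasis K n).repr v i) • spikeBasis K n i := by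
  conv_lhs => rw [← (spikeBasis K n).sum_repr v]
  rw [map_sum]
  exact Finset.sum_congr rfl fun i _ => by rw [map_smul, SbC_diag_spikeBasis, smul_smul, mul_comm]

/-- hence `repr (SbC(a 0 0 d) v) i = a^{n−i} d^i · repr v i`. -/
theorem repr_SbC_diag (a d : K) (v : spikeSpan K n) (i : Fin (n + 1)) :
    (spikeBasis K n).repr (SbC K a 0 0 d v) i = a ^ (n - (i : ℕ)) * d ^ (i : ℕ) * (spikeBasis K n).repr v i := by
  rw [SbC_diag_eq_sum, Basis.repr_sum_self]

/-- **AN ENDOMORPHISM COMMUTING WITH THE TORUS ELEMENT `SbC(1 0 0 t)` (`t^0, …, t^n` pairwise distinct) IS DIAGONAL IN TH-7's BASIS: `φ E_q = (repr (φ E_q) q) • E_q`.** -/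
theorem apply_spikeBasis_eq_smul_of_commute_torus {t : K} (ht : Function.Injective fun q : Fin (n + 1) => t ^ (q : ℕ)) {φ : spikeSpan K n →ₗ[K] spikeSpan K n}
    (hφ : φ * SbC K 1 0 0 t = SbC K 1 0 0 t * φ) (q : Fin (n + 1)) : φ (spikeBasis K n q) = (spikeBasis K n).repr (φ (spikeBasis K n q)) q • spikeBasis K n q := by
  -- every other coordinate of `φ E_q` vanishes: `t^i c_i = t^q c_i`
  have hc : ∀ i : Fin (n + 1), i ≠ q → (spikeBasis K n).repr (φ (spikeBasis K n q)) i = 0 := fun i hi => by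
    have h := congrArg (fun ψ : spikeSpan K n →ₗ[K] spikeSpan K n => (spikeBasis K n).repr (ψ (spikeBasis K n q)) i) hφ
    simp only [Module.End.mul_apply] at h
    rw [SbC_diag_spikeBasis, map_smul, map_smul, Finsupp.smul_apply, smul_eq_mul, repr_SbC_diag, one_pow, one_mul, one_pow, one_mul] at h
    -- h : t^q * c_i = t^i * c_i
    by_contra hne
    exact hi (ht (mul_right_cancel₀ hne h).symm)
  conv_lhs => rw [← (spikeBasis K n).sum_repr (φ (spikeBasis K n q))]
  rw [Finset.sum_eq_single q (fun i _ hi => by rw [hc i hi, zero_smul]) (fun h => absurd (Finset.mem_univ q) h)]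

/-- the shear of the pure class has all spike coordinates `1`: `SbC(1 1 0 1) E_0 = Σ_a E_a` (`C(a,0) = 1`). -/
theorem SbC_shear_one_spikeBasis_zero : SbC K 1 1 0 1 (spikeBasis K n 0) = ∑ a : Fin (n + 1), spikeBasis K n a := by
  conv_lhs => rw [← (spikeBasis K n).sum_repr (SbC K 1 1 0 1 (spikeBasis K n 0))]
  exact Finset.sum_congr rfl fun a _ => by
    rw [repr_SbC_spikeBasis, sbMat_shear_apply, Fin.val_zero, if_pos (Nat.zero_le _), Nat.choose_zero_right, Nat.cast_one, one_pow, mul_one, one_smul]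

/-- **SCHUR IN EVERY CHARACTERISTIC: an endomorphism of th-7's class space commuting with the torus element `SbC(1 0 0 t)` (`t^0, …, t^n` pairwise distinct) and the shear
`SbC(1 1 0 1)` is a scalar, `φ = (repr (φ E_0) 0) • 1`** — no hypothesis on the binomial coefficients (only `C(a,0) = 1` enters). -/
theorem eq_smul_one_of_commute_torus_shear {t : K} (ht : Function.Injective fun q : Fin (n + 1) => t ^ (q : ℕ)) {φ : spikeSpan K n →ₗ[K] spikeSpan K n}
    (hT : φ * SbC K 1 0 0 t = SbC K 1 0 0 t * φ) (hU : φ * SbC K 1 1 0 1 = SbC K 1 1 0 1 * φ) :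
    φ = (spikeBasis K n).repr (φ (spikeBasis K n 0)) 0 • (1 : spikeSpan K n →ₗ[K] spikeSpan K n) := by
  set c : Fin (n + 1) → K := fun q => (spikeBasis K n).repr (φ (spikeBasis K n q)) q with hc
  have hdiag := apply_spikeBasis_eq_smul_of_commute_torus K ht hT
  -- compare `φ (U E_0) = Σ c_a E_a` with `U (φ E_0) = c_0 Σ E_a`
  have hca : ∀ a : Fin (n + 1), c a = c 0 := fun a => by
    have h := congrArg (fun ψ : spikeSpan K n →ₗ[K] spikeSpan K n => (spikeBasis K n).repr (ψ (spikeBasis K n 0)) a) hU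
    simp only [Module.End.mul_apply] at h
    rw [SbC_shear_one_spikeBasis_zero, map_sum, hdiag 0, map_smul, SbC_shear_one_spikeBasis_zero, Finset.smul_sum] at h
    have e1 : (∑ x : Fin (n + 1), φ (spikeBasis K n x)) = ∑ x : Fin (n + 1), c x • spikeBasis K n x := Finset.sum_congr rfl fun x _ => hdiag x
    rw [e1, Basis.repr_sum_self, Basis.repr_sum_self] at h
    exact h
  refine (spikeBasis K n).ext fun a => ?_
  rw [hdiag a, LinearMap.smul_apply, Module.End.one_apply]
  exact congrArg (· • spikeBasis K n a) (hca a)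

/-- **hence an endomorphism commuting with EVERY substitution is a scalar** (such `t` in `K`; J13's `n! ≠ 0` hypothesis removed). -/
theorem eq_smul_one_of_forall_commute_SbC_of_pow_injective {t : K} (ht : Function.Injective fun q : Fin (n + 1) => t ^ (q : ℕ)) {φ : spikeSpan K n →ₗ[K] spikeSpan K n}
    (hall : ∀ α β γ δ : K, φ * SbC K α β γ δ = SbC K α β γ δ * φ) : ∃ c : K, φ = c • (1 : spikeSpan K n →ₗ[K] spikeSpan K n) :=
  ⟨_, eq_smul_one_of_commute_torus_shear K ht (hall 1 0 0 t) (hall 1 1 0 1)⟩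

/-- **over every infinite field: the commutant of the substitutions on th-7's class space is the scalars**, in every characteristic. -/
theorem eq_smul_one_of_forall_commute_SbC_of_infinite [Infinite K] {φ : spikeSpan K n →ₗ[K] spikeSpan K n} (hall : ∀ α β γ δ : K, φ * SbC K α β γ δ = SbC K α β γ δ * φ) :
    ∃ c : K, φ = c • (1 : spikeSpan K n →ₗ[K] spikeSpan K n) := by
  obtain ⟨t, ht⟩ := exists_pow_injective_of_infinite K n
  exact eq_smul_one_of_forall_commute_SbC_of_pow_injective K ht hall

/-! ## §286. Indecomposability -/

section Proj

variable {V : Type*} [AddCommGroup V] [Module K V]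

/-- the projection onto `W` along a complement `W'` (`LinearMap.ofIsCompl h W.subtype 0`) commutes with every endomorphism leaving BOTH `W` and `W'` stable. -/
theorem commute_ofIsCompl_of_stable {W W' : Submodule K V} (h : IsCompl W W') {f : V →ₗ[K] V} (hW : ∀ v ∈ W, f v ∈ W) (hW' : ∀ v ∈ W', f v ∈ W') :
    LinearMap.ofIsCompl h W.subtype 0 * f = f * LinearMap.ofIsCompl h W.subtype 0 := by
  have hl : ∀ u ∈ W, LinearMap.ofIsCompl h W.subtype 0 u = u := fun u hu => by
    have e := LinearMap.ofIsCompl_apply_left h (φ := W.subtype) (ψ := (0 : W' →ₗ[K] V)) ⟨u, hu⟩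
    rwa [Submodule.subtype_apply] at e
  have hr : ∀ v ∈ W', LinearMap.ofIsCompl h W.subtype 0 v = 0 := fun v hv => by
    have e := LinearMap.ofIsCompl_apply_right h (φ := W.subtype) (ψ := (0 : W' →ₗ[K] V)) ⟨v, hv⟩
    rwa [LinearMap.zero_apply] at e
  refine LinearMap.ext fun x => ?_
  obtain ⟨u, hu, v, hv, rfl⟩ := Submodule.mem_sup.mp (show x ∈ W ⊔ W' by rw [h.sup_eq_top]; exact Submodule.mem_top)
  rw [Module.End.mul_apply, Module.End.mul_apply, map_add, map_add, map_add, hl u hu, hr v hv, hl _ (hW u hu), hr _ (hW' v hv), add_zero, add_zero]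

end Proj

/-- **TH-7's CLASS SPACE IS INDECOMPOSABLE UNDER THE TORUS AND THE SHEAR: if `spikeSpan n = W ⊕ W'` with both summands stable under `SbC(1 0 0 t)` (`t^0, …, t^n` distinct) and
`SbC(1 1 0 1)`, then `W = ⊥` or `W = ⊤`** (the projection onto `W` along `W'` is in the commutant, hence a scalar idempotent: `0` or `1`). -/
theorem eq_bot_or_eq_top_of_isCompl_stable {t : K} (ht : Function.Injective fun q : Fin (n + 1) => t ^ (q : ℕ)) {W W' : Submodule K (spikeSpan K n)} (h : IsCompl W W')
    (hTW : ∀ v ∈ W, SbC K 1 0 0 t v ∈ W) (hTW' : ∀ v ∈ W', SbC K 1 0 0 t v ∈ W') (hUW : ∀ v ∈ W, SbC K 1 1 0 1 v ∈ W) (hUW' : ∀ v ∈ W', SbC K 1 1 0 1 v ∈ W') :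
    W = ⊥ ∨ W = ⊤ := by
  have hc := eq_smul_one_of_commute_torus_shear K ht (commute_ofIsCompl_of_stable K h hTW hTW') (commute_ofIsCompl_of_stable K h hUW hUW')
  set π : spikeSpan K n →ₗ[K] spikeSpan K n := LinearMap.ofIsCompl h W.subtype 0 with hπ
  set c : K := (spikeBasis K n).repr (π (spikeBasis K n 0)) 0 with hcdef
  have hπW : ∀ w ∈ W, π w = w := fun w hw => by
    have e := LinearMap.ofIsCompl_apply_left h (φ := W.subtype) (ψ := (0 : W' →ₗ[K] spikeSpan K n)) ⟨w, hw⟩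
    rwa [Submodule.subtype_apply] at e
  have hπW' : ∀ w ∈ W', π w = 0 := fun w hw => by
    have e := LinearMap.ofIsCompl_apply_right h (φ := W.subtype) (ψ := (0 : W' →ₗ[K] spikeSpan K n)) ⟨w, hw⟩
    rwa [LinearMap.zero_apply] at e
  by_cases hW : W = ⊥
  · exact Or.inl hW
  · right
    obtain ⟨w, hw, hw0⟩ := (Submodule.ne_bot_iff W).mp hW
    -- `π w = w = c • w` forces `c = 1`
    have hc1 : c = 1 := by
      have e := hπW w hw
      rw [hc, LinearMap.smul_apply, Module.End.one_apply] at e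
      exact smul_left_injective K hw0 (e.trans (one_smul K w).symm)
    -- then `π = 1` kills nothing, so `W' = ⊥`
    have hW' : W' = ⊥ := by
      rw [eq_bot_iff]
      intro w' hw'
      have e := hπW' w' hw'
      rw [hc, hc1, one_smul, Module.End.one_apply] at e
      exact (Submodule.mem_bot K).mpr e
    exact eq_top_of_isCompl_bot (hW' ▸ h)

/-- **hence no decomposition of the class space into two non-zero subspaces stable under all substitutions exists** (such `t` in `K`). -/
theorem eq_bot_or_eq_top_of_isCompl_forall_SbC_stable {t : K} (ht : Function.Injective fun q : Fin (n + 1) => t ^ (q : ℕ)) {W W' : Submodule K (spikeSpan K n)}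
    (h : IsCompl W W') (hW : ∀ α β γ δ : K, ∀ v ∈ W, SbC K α β γ δ v ∈ W) (hW' : ∀ α β γ δ : K, ∀ v ∈ W', SbC K α β γ δ v ∈ W') : W = ⊥ ∨ W = ⊤ :=
  eq_bot_or_eq_top_of_isCompl_stable K ht h (hW 1 0 0 t) (hW' 1 0 0 t) (hW 1 1 0 1) (hW' 1 1 0 1)

/-- **over every infinite field, in every characteristic: th-7's class space is indecomposable under the substitutions.** -/
theorem eq_bot_or_eq_top_of_isCompl_forall_SbC_stable_of_infinite [Infinite K] {W W' : Submodule K (spikeSpan K n)} (h : IsCompl W W')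
    (hW : ∀ α β γ δ : K, ∀ v ∈ W, SbC K α β γ δ v ∈ W) (hW' : ∀ α β γ δ : K, ∀ v ∈ W', SbC K α β γ δ v ∈ W') : W = ⊥ ∨ W = ⊤ := by
  obtain ⟨t, ht⟩ := exists_pow_injective_of_infinite K n
  exact eq_bot_or_eq_top_of_isCompl_forall_SbC_stable K ht h hW hW'

/-- **REDUCIBLE BUT INDECOMPOSABLE: for `n = p^e`, `e ≥ 1`, in characteristic `p` over an infinite field, th-7's class space HAS a proper non-zero subspace stable under all
substitutions (the Siegel classes, K3/J8), yet admits NO pair of complementary non-zero stable subspaces.** -/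
theorem reducible_and_indecomposable_prime_pow [Infinite K] (p : ℕ) [Fact p.Prime] [CharP K p] {e : ℕ} (he : 1 ≤ e) :
    (∃ W : Submodule K (spikeSpan K (p ^ e)), (∀ α β γ δ : K, ∀ v ∈ W, SbC K α β γ δ v ∈ W) ∧ W ≠ ⊥ ∧ W ≠ ⊤) ∧
    (∀ W W' : Submodule K (spikeSpan K (p ^ e)), IsCompl W W' → (∀ α β γ δ : K, ∀ v ∈ W, SbC K α β γ δ v ∈ W) →
      (∀ α β γ δ : K, ∀ v ∈ W', SbC K α β γ δ v ∈ W') → W = ⊥ ∨ W = ⊤) := by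
  have hp : p.Prime := Fact.out
  refine ⟨⟨_, fun α β γ δ v hv => SbC_mem_comap_siegel K α β γ δ hv, fun hb => ?_, comap_siegel_ne_top K⟩,
    fun W W' h hW hW' => eq_bot_or_eq_top_of_isCompl_forall_SbC_stable_of_infinite K h hW hW'⟩
  -- `C(p^e, 1) = p^e = 0` in `K`, so the Siegel classes are non-zero
  have h1 : 1 ≤ p ^ e := Nat.one_le_pow e p hp.pos
  exact (comap_siegel_eq_bot_iff K).mp hb 1 h1 (by rw [Nat.choose_one_right, CharP.cast_eq_zero_iff K p]; exact dvd_pow_self p (by omega))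

/-! ## §294. The numerology of irreducibility: `n + 1 = (d+1)·p^k` -/

/-- **OVER AN INFINITE FIELD OF CHARACTERISTIC `p`: th-7's class space of degree `n` is IRREDUCIBLE under the substitutions IFF `n + 1 = (d+1)·p^k` for some `d < p`, `k`**
(K3's criterion «every `C(n,j)` non-zero in `K`» = I19's `coSiegel_n ⊓ SI_n = ⊥` = J16's digit form: all base-`p` digits of `n` below the leading one are `p − 1`;
dictionary: `Sym^n = St_k ⊗ L(d)^{[k]}`). -/
theorem forall_stable_eq_top_iff_exists_digits_of_infinite [Infinite K] (p : ℕ) [Fact p.Prime] [CharP K p] :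
    (∀ W : Submodule K (spikeSpan K n), (∀ α β γ δ : K, ∀ f ∈ W, SbC K α β γ δ f ∈ W) → W ≠ ⊥ → W = ⊤) ↔ ∃ k d : ℕ, d < p ∧ n + 1 = (d + 1) * p ^ k := by
  rw [forall_stable_eq_top_iff_choose_ne_zero_of_infinite, ← coSiegel_inf_siegelIdeal_eq_bot_iff, coSiegel_inf_siegelIdeal_eq_bot_iff_exists_digits K p Fact.out]

/-- in particular (infinite field, characteristic `p`): **degree `n = p^k − 1` is irreducible** (`d = 0`)… -/
theorem forall_stable_eq_top_of_prime_pow_sub_one [Infinite K] (p : ℕ) [Fact p.Prime] [CharP K p] (k : ℕ) (hn : n + 1 = p ^ k)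
    {W : Submodule K (spikeSpan K n)} (hW : ∀ α β γ δ : K, ∀ f ∈ W, SbC K α β γ δ f ∈ W) (hW0 : W ≠ ⊥) : W = ⊤ :=
  (forall_stable_eq_top_iff_exists_digits_of_infinite K p).mpr ⟨k, 0, (Fact.out : p.Prime).pos, by rw [zero_add, one_mul]; exact hn⟩ W hW hW0

/-- … while **degree `n = p^k` (`k ≥ 1`) is reducible but indecomposable** (`reducible_and_indecomposable_prime_pow`, restated through the numerology: `p^k + 1` is not of the
form `(d+1)p^j` with `d < p` unless `p = 2`, `k = 1`… — not needed: the reducibility is J8's). -/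
theorem not_forall_stable_eq_top_prime_pow [Infinite K] (p : ℕ) [Fact p.Prime] [CharP K p] {e : ℕ} (he : 1 ≤ e) :
    ¬ ∀ W : Submodule K (spikeSpan K (p ^ e)), (∀ α β γ δ : K, ∀ f ∈ W, SbC K α β γ δ f ∈ W) → W ≠ ⊥ → W = ⊤ := by
  obtain ⟨⟨W, hW, hb, ht⟩, -⟩ := reducible_and_indecomposable_prime_pow K p he
  exact fun h => ht (h W hW hb)

end Summit.Ventures.HSemireg.Wedge.HankelFrameChange
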